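import Summits.AtomisticToContinuum.FouriersLaw.Theorems.BondHeatUncertaintyBoundedResponseTransientBandA

/-!
# `TransientBand` — the blocker `BoundedResponse` (11071) split at the Thouless time by the escape transient (lens-1 g92 node B) — part 2 of 5 (sequel of `…BondHeatUncertaintyBoundedResponseTransientBandA`)

Split for the 400-line cap by the landing lane (hand-2 g35); the module docstring of part 1 (`…BondHeatUncertaintyBoundedResponseTransientBandA`) describes the whole node.  Same namespace; all FQNs unchanged.
0 sorry; standard axioms.
-/

noncomputable section
open MeasureTheory Filter Topology Set
open Literature.MathematicalPhysics.KineticTheory.HeatConduction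

namespace Summit.AtomisticToContinuum.FouriersLaw.Theorems.BoundedResponse.TransientBand

open Summit.AtomisticToContinuum.FouriersLaw.Theses.BondHeatUncertainty (BoundedResponse)
open Summit.AtomisticToContinuum.FouriersLaw.Theses.GriffithsLimitExchange (BoundaryDEP)
open Summit.AtomisticToContinuum.FouriersLaw.Theorems.SubdiffusiveBondHeat
  (boundaryKernelBasics_proof pinnedChain_primitive_kinKernel_integral_eq escapeDeficit_nonneg escapeDeficit_le_one
    boundedResponse_iff_ohmicFloor)
open Summit.AtomisticToContinuum.FouriersLaw.Theorems.SubdiffusiveBondHeat.EscapeGrading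
  (escapeDeficit OhmicFloor ExponentFloor ohmicFloor_iff_boundedResponse exponentFloor_one_iff_ohmicFloor)
open Summit.AtomisticToContinuum.FouriersLaw.Theorems.BoundedResponse.TransientContact (contactImbalanceCorr)

/-! ## §3 The N-uniform pieces -/

/-- **`DeficitCesaroPoint` (D)** — the Cesàro deficit AT THE THOULESS TIME is `O(N)`:
`∃ C, c > 0, N₀: ∀ N ≥ N₀, W_N(cN²) ≤ C·N`.  The registered open stub `stub_deficitCesaroEW` of crux 9120
(`W_N(t) ≤ C√t` on the whole window `[1, cN²]`) evaluated at ONE time (`deficitCesaroPoint_of_deficitCesaroEW`): STRICTLY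
WEAKER than the stub.  Physics: the hot contact injects only `O(N)·δ` of heat up to the Thouless time (finite heat capacity per
site, no ballistic leak).  Tags: UNDECIDED · FALSE for the harmonic member (`W_N(t) ≥ t·E_N^{harm} = t/8` at `ω₂ = γ = 1`,
`E_N^{harm}` constant in `N`) · WEAKER than `stub_deficitCesaroEW` · with the transient band, EQUIVALENT to 11071
(`boundedResponse_iff_deficitCesaroPoint`). (piece · rung) [route statement · this cell; NOT a literature fact] -/
def DeficitCesaroPoint : Prop :=
  ∀ ω₂ lam β γ : ℝ, 0 < ω₂ → 0 < lam → 0 < β → 0 < γ → ∀ T : ℝ, 0 < T →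
    ∃ C c : ℝ, 0 < c ∧ ∃ N₀ : ℕ, ∀ N : ℕ, N₀ ≤ N →
      deficitCesaro ω₂ lam β γ T N (c * (N : ℝ) ^ 2) ≤ C * (N : ℝ)

/-- **`TransientFloor g` (F_g)** — the graded FLOOR of the escape transient at the Thouless time:
`∀ c > 0 ∃ C N₀ ∀ N ≥ N₀, Ov_N(cN²) ≥ −C·N^g` (larger `g` = WEAKER; `transientFloor_mono`).  `g = 1` is the sharp grade:
with (D) it gives exactly the Ohmic floor (`ohmicFloor_of_deficitCesaroPoint_transientFloor`), and it follows from 11071 modulo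
the Cesàro floor (`transientFloor_one_of_ohmicFloor_deficitCesaroFloor`); `1 ≤ g ≤ 2` gives the sub-Ohmic rungs `ExponentFloor (2 − g)`
of `EscapeGrading` (`exponentFloor_of_deficitCesaroPoint_transientFloor`).  Implied at EVERY grade by the dynamical Griffiths
sign `BoundaryDEP` (13198; `transientFloor_of_boundaryDEP`), in particular TRUE for the harmonic member (Isserlis, `K_N ≥ 0`);
`g = 4` is free by Bochner (`Ov_N(t) ≥ −γt²`, not typed here).  Content at `g = 1`: no RETARDED OVERSHOOT of the contact
temperature above its final value by more than the Ohmic scale, `∫₀^{cN²}(θ_N(s) − θ_N(∞))₊ ds = O(N)` — the finite-`N` shadow of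
the maximum principle of the limiting heat equation.  Tags (`g = 1`): UNDECIDED · TRUE for phonons · ⟸ BoundaryDEP ·
WEAKER than 11071 modulo `DeficitCesaroFloor` · ⟺ the contact-surplus floor of node A modulo statics
(`contactSurplusFloor_iff_transientFloor_one`). (piece · rung) [route statement · this cell; NOT a literature fact] -/
def TransientFloor (g : ℝ) : Prop :=
  ∀ ω₂ lam β γ : ℝ, 0 < ω₂ → 0 < lam → 0 < β → 0 < γ → ∀ T : ℝ, 0 < T → ∀ c : ℝ, 0 < c →
    ∃ C : ℝ, ∃ N₀ : ℕ, ∀ N : ℕ, N₀ ≤ N →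
      -(C * (N : ℝ) ^ g) ≤ escapeTransient ω₂ lam β γ T N (c * (N : ℝ) ^ 2)

/-- **`TransientCeilingPoint` (U)** — the CEILING of the escape transient at the Thouless time, `Ov_N(cN²) ≤ C·N` for some
window constant `c > 0`: the tree's `TransientEW` (`Ov_N(t) ≤ C₂√t` on `[1, cN²]`, hypothesis 2 of p138777) at one time
(`transientCeilingPoint_of_transientEW`).  Role: with it, 11071 gives back (D) (`deficitCesaroPoint_of_ohmicFloor_transientCeiling`).
Tags: UNDECIDED · WEAKER than `TransientEW` · plausible for phonons (`K_N^{harm} ∈ L¹(u du)` before the echo times).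
(piece · rung) [route statement · this cell; NOT a literature fact] -/
def TransientCeilingPoint : Prop :=
  ∀ ω₂ lam β γ : ℝ, 0 < ω₂ → 0 < lam → 0 < β → 0 < γ → ∀ T : ℝ, 0 < T →
    ∃ C c : ℝ, 0 < c ∧ ∃ N₀ : ℕ, ∀ N : ℕ, N₀ ≤ N →
      escapeTransient ω₂ lam β γ T N (c * (N : ℝ) ^ 2) ≤ C * (N : ℝ)

/-- **`DeficitCesaroFloor`** — `∀ c > 0 ∃ C N₀ ∀ N ≥ N₀, W_N(cN²) ≥ −C·N`: the time-averaged heat current drawn from the raised bath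
does not REVERSE by more than the Ohmic scale up to the Thouless time (true with `C = 0` whenever `θ_N ≤ 1`, e.g. under
`BoundaryDEP`: `deficitCesaroFloor_of_boundaryDEP`).  Only used to certify that `TransientFloor 1` is WEAKER than 11071. Tags:
UNDECIDED (expected TRUE) · ⟸ BoundaryDEP.  (Name: NOT the route item `ChannelExclusionTauberian.CesaroFloor`, stmt-28289, a floor on
the Cesàro MEANS OF THE RESPONSE `D_N`; this is a floor on the deficit's Cesàro integral `W_N` at the Thouless time.)
(piece · rung) [route statement · this cell; NOT a literature fact] -/
def DeficitCesaroFloor : Prop :=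
  ∀ ω₂ lam β γ : ℝ, 0 < ω₂ → 0 < lam → 0 < β → 0 < γ → ∀ T : ℝ, 0 < T → ∀ c : ℝ, 0 < c →
    ∃ C : ℝ, ∃ N₀ : ℕ, ∀ N : ℕ, N₀ ≤ N →
      -(C * (N : ℝ)) ≤ deficitCesaro ω₂ lam β γ T N (c * (N : ℝ) ^ 2)

/-! ## §4 The door: `(D) ∧ (F₁) ⟹ OhmicFloor ⟺ 11071`, and the graded ladder -/

/-- Grades are monotone: `g ≤ g' ⟹ F_g ⟹ F_{g'}`. [folklore] -/
theorem transientFloor_mono {g g' : ℝ} (hgg' : g ≤ g') : TransientFloor g → TransientFloor g' := by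
  intro h ω₂ lam β γ hω hl hβ hγ T hT c hc
  obtain ⟨C, N₀, hF⟩ := h ω₂ lam β γ hω hl hβ hγ T hT c hc
  refine ⟨max C 0, max N₀ 1, fun N hN => ?_⟩
  have hN1 : (1 : ℝ) ≤ N := by exact_mod_cast le_trans (le_max_right _ _) hN
  have h1 := hF N (le_trans (le_max_left _ _) hN)
  have hpow : (N : ℝ) ^ g ≤ (N : ℝ) ^ g' := Real.rpow_le_rpow_of_exponent_le hN1 hgg'
  have hCg : C * (N : ℝ) ^ g ≤ max C 0 * (N : ℝ) ^ g' :=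
    le_trans (mul_le_mul_of_nonneg_right (le_max_left _ _) (by positivity))
      (mul_le_mul_of_nonneg_left hpow (le_max_right _ _))
  linarith

/-- **THE DOOR.**  `DeficitCesaroPoint ∧ TransientFloor 1 ⟹ OhmicFloor`: at `t = cN²`,
`cN²·E_N = W_N(t) − Ov_N(t) ≤ C·N + C'·N`, so `E_N ≤ ((C⁺ + C'⁺)/c)/N`.  Two (S)-line residuals in escape currency, each
STRICTLY WEAKER than 11071-with-band and separated by the harmonic member (F₁ true, D false there); no `(K)`, no TUR budget,
no bond-heat variance. [folklore] -/
theorem ohmicFloor_of_deficitCesaroPoint_transientFloor :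
    DeficitCesaroPoint → TransientFloor 1 → OhmicFloor := by
  intro hD hF ω₂ lam β γ hω hl hβ hγ T hT
  obtain ⟨C, c, hc, N₀, hW⟩ := hD ω₂ lam β γ hω hl hβ hγ T hT
  obtain ⟨C', N₀', hOv⟩ := hF ω₂ lam β γ hω hl hβ hγ T hT c hc
  refine ⟨(max C 0 + max C' 0) / c, max (max N₀ N₀') 1, fun N hN => ?_⟩
  have hN₀ : N₀ ≤ N := le_trans (le_trans (le_max_left _ _) (le_max_left _ _)) hN
  have hN₀' : N₀' ≤ N := le_trans (le_trans (le_max_right _ _) (le_max_left _ _)) hN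
  have hNpos : (0 : ℝ) < N := by exact_mod_cast lt_of_lt_of_le Nat.one_pos (le_trans (le_max_right _ _) hN)
  have ht : (0 : ℝ) ≤ c * (N : ℝ) ^ 2 := by positivity
  have hid := deficitCesaro_eq_add hω hl hβ hγ hT N ht
  have h1 := hW N hN₀
  have h2 := hOv N hN₀'
  rw [Real.rpow_one] at h2
  set E := escapeDeficit ω₂ lam β γ T N with hE
  have hCN : C * (N : ℝ) ≤ max C 0 * N := mul_le_mul_of_nonneg_right (le_max_left _ _) hNpos.le
  have hC'N : C' * (N : ℝ) ≤ max C' 0 * N := mul_le_mul_of_nonneg_right (le_max_left _ _) hNpos.le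
  have key : c * (N : ℝ) ^ 2 * E ≤ (max C 0 + max C' 0) * N := by nlinarith [hid, h1, h2, hCN, hC'N]
  rw [div_div, le_div_iff₀ (mul_pos hc hNpos)]
  have : E * (c * N) * N ≤ (max C 0 + max C' 0) * N := by nlinarith [key]
  exact le_of_mul_le_mul_right this hNpos

/-- **`DeficitCesaroPoint ∧ TransientFloor 1 ⟹ BoundedResponse` (stmt-AtomisticToContinuum-11071).** [folklore] -/
theorem boundedResponse_of_deficitCesaroPoint_transientFloor :
    DeficitCesaroPoint → TransientFloor 1 → BoundedResponse := fun hD hF =>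
  ohmicFloor_iff_boundedResponse.mp (ohmicFloor_of_deficitCesaroPoint_transientFloor hD hF)

/-- **The sub-Ohmic rungs.**  For `g ≥ 1`: `DeficitCesaroPoint ∧ TransientFloor g ⟹ ExponentFloor (2 − g)`
(`E_N ≤ C/N^{2−g}`; `g = 1` is the Ohmic rung, `g = 3/2` gives `HalfOhmicFloor`, `g ≥ 2` only the free `ExponentFloor (≤ 0)`).
[folklore] -/
theorem exponentFloor_of_deficitCesaroPoint_transientFloor {g : ℝ} (hg₁ : 1 ≤ g) :
    DeficitCesaroPoint → TransientFloor g → ExponentFloor (2 - g) := by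
  intro hD hF ω₂ lam β γ hω hl hβ hγ T hT
  obtain ⟨C, c, hc, N₀, hW⟩ := hD ω₂ lam β γ hω hl hβ hγ T hT
  obtain ⟨C', N₀', hOv⟩ := hF ω₂ lam β γ hω hl hβ hγ T hT c hc
  refine ⟨(max C 0 + max C' 0) / c, max (max N₀ N₀') 1, fun N hN => ?_⟩
  have hN₀ : N₀ ≤ N := le_trans (le_trans (le_max_left _ _) (le_max_left _ _)) hN
  have hN₀' : N₀' ≤ N := le_trans (le_trans (le_max_right _ _) (le_max_left _ _)) hN
  have hN1 : (1 : ℝ) ≤ N := by exact_mod_cast le_trans (le_max_right _ _) hN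
  have hNpos : (0 : ℝ) < N := lt_of_lt_of_le one_pos hN1
  have ht : (0 : ℝ) ≤ c * (N : ℝ) ^ 2 := by positivity
  have hid := deficitCesaro_eq_add hω hl hβ hγ hT N ht
  have h1 := hW N hN₀
  have h2 := hOv N hN₀'
  have hg0 : (0 : ℝ) ≤ (N : ℝ) ^ g := by positivity
  have hNg : (N : ℝ) ≤ (N : ℝ) ^ g := by
    have := Real.rpow_le_rpow_of_exponent_le hN1 hg₁
    rwa [Real.rpow_one] at this
  set E := escapeDeficit ω₂ lam β γ T N with hE
  have hCN : C * (N : ℝ) ≤ max C 0 * (N : ℝ) ^ g :=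
    le_trans (mul_le_mul_of_nonneg_right (le_max_left _ _) hNpos.le)
      (mul_le_mul_of_nonneg_left hNg (le_max_right _ _))
  have hC'N : C' * (N : ℝ) ^ g ≤ max C' 0 * (N : ℝ) ^ g := mul_le_mul_of_nonneg_right (le_max_left _ _) hg0
  have key : c * (N : ℝ) ^ 2 * E ≤ (max C 0 + max C' 0) * (N : ℝ) ^ g := by nlinarith [hid, h1, h2, hCN, hC'N]
  have hsplit : (N : ℝ) ^ (2 - g) = (N : ℝ) ^ 2 / (N : ℝ) ^ g := by
    rw [Real.rpow_sub hNpos, Real.rpow_two]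
  rw [hsplit, div_div_eq_mul_div, le_div_iff₀ (by positivity), div_mul_eq_mul_div, le_div_iff₀ hc]
  linarith [key]

/-- **`DeficitCesaroGrade h` (D_h)** — the injection-exponent ladder on the stub side: `∃ C, c > 0, N₀: ∀ N ≥ N₀,
W_N(cN²) ≤ C·N^h` (larger `h` = WEAKER).  `h = 1` is (D) (`deficitCesaroGrade_one_iff`; Edwards–Wilkinson / diffusive injection
`W_N(t) ≲ √t`), `h = 2` is PROVED (`deficitCesaroGrade_two`, from the tree's `W_N(t) ≤ t`), `1 < h < 2` = anomalous (super-diffusive)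
injection `W_N(t) ≲ t^{h/2}`.  With the matching floor, ANY sub-ballistic pair of grades gives a positive escape exponent:
`D_h ∧ F_g ⟹ ExponentFloor (2 − max g h)` (`exponentFloor_of_grades`). Tags: `h = 2` PROVED · `h < 2` UNDECIDED · `h = 1` ⟺ (D).
(piece · rung) [route statement · this cell; NOT a literature fact] -/
def DeficitCesaroGrade (h : ℝ) : Prop :=
  ∀ ω₂ lam β γ : ℝ, 0 < ω₂ → 0 < lam → 0 < β → 0 < γ → ∀ T : ℝ, 0 < T →
    ∃ C c : ℝ, 0 < c ∧ ∃ N₀ : ℕ, ∀ N : ℕ, N₀ ≤ N →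
      deficitCesaro ω₂ lam β γ T N (c * (N : ℝ) ^ 2) ≤ C * (N : ℝ) ^ h

/-- `D_1 ⟺ (D)`. [folklore] -/
theorem deficitCesaroGrade_one_iff : DeficitCesaroGrade 1 ↔ DeficitCesaroPoint := by
  simp only [DeficitCesaroGrade, DeficitCesaroPoint, Real.rpow_one]

/-- **The ballistic rung `D_2` is a THEOREM** (`W_N(N²) ≤ N²`, the tree's `deficitCesaro_le_self`). [folklore] -/
theorem deficitCesaroGrade_two : DeficitCesaroGrade 2 := by
  intro ω₂ lam β γ hω hl hβ hγ T hT
  refine ⟨1, 1, one_pos, 0, fun N _ => ?_⟩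
  have ht : (0 : ℝ) ≤ 1 * (N : ℝ) ^ 2 := by positivity
  have h := Summit.AtomisticToContinuum.FouriersLaw.Theorems.SubdiffusiveBondHeat.deficitCesaro_le_self
    ω₂ lam β γ hω hl hβ hγ T hT N (1 * (N : ℝ) ^ 2) ht
  rw [Real.rpow_two]
  simpa [deficitCesaro, stepResponse, escapeKernel] using h

/-- **The two-exponent ladder**: `D_h ∧ F_g ⟹ ExponentFloor (2 − max g h)` — at `t = cN²`,
`cN²·E_N = W_N − Ov_N ≤ C·N^h + C'·N^g ≤ (C⁺ + C'⁺)·N^{max g h}`. [folklore] -/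
theorem exponentFloor_of_grades {g h : ℝ} : DeficitCesaroGrade h → TransientFloor g → ExponentFloor (2 - max g h) := by
  intro hD hF ω₂ lam β γ hω hl hβ hγ T hT
  obtain ⟨C, c, hc, N₀, hW⟩ := hD ω₂ lam β γ hω hl hβ hγ T hT
  obtain ⟨C', N₀', hOv⟩ := hF ω₂ lam β γ hω hl hβ hγ T hT c hc
  refine ⟨(max C 0 + max C' 0) / c, max (max N₀ N₀') 1, fun N hN => ?_⟩
  have hN₀ : N₀ ≤ N := le_trans (le_trans (le_max_left _ _) (le_max_left _ _)) hN
  have hN₀' : N₀' ≤ N := le_trans (le_trans (le_max_right _ _) (le_max_left _ _)) hN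
  have hN1 : (1 : ℝ) ≤ N := by exact_mod_cast le_trans (le_max_right _ _) hN
  have hNpos : (0 : ℝ) < N := lt_of_lt_of_le one_pos hN1
  have ht : (0 : ℝ) ≤ c * (N : ℝ) ^ 2 := by positivity
  have hid := deficitCesaro_eq_add hω hl hβ hγ hT N ht
  have h1 := hW N hN₀
  have h2 := hOv N hN₀'
  set m := max g h with hm
  have hm0 : (0 : ℝ) ≤ (N : ℝ) ^ m := by positivity
  have hNg : (N : ℝ) ^ g ≤ (N : ℝ) ^ m := Real.rpow_le_rpow_of_exponent_le hN1 (le_max_left _ _)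
  have hNh : (N : ℝ) ^ h ≤ (N : ℝ) ^ m := Real.rpow_le_rpow_of_exponent_le hN1 (le_max_right _ _)
  set E := escapeDeficit ω₂ lam β γ T N with hE
  have hCN : C * (N : ℝ) ^ h ≤ max C 0 * (N : ℝ) ^ m :=
    le_trans (mul_le_mul_of_nonneg_right (le_max_left _ _) (by positivity))
      (mul_le_mul_of_nonneg_left hNh (le_max_right _ _))
  have hC'N : C' * (N : ℝ) ^ g ≤ max C' 0 * (N : ℝ) ^ m :=
    le_trans (mul_le_mul_of_nonneg_right (le_max_left _ _) (by positivity))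
      (mul_le_mul_of_nonneg_left hNg (le_max_right _ _))
  have key : c * (N : ℝ) ^ 2 * E ≤ (max C 0 + max C' 0) * (N : ℝ) ^ m := by nlinarith [hid, h1, h2, hCN, hC'N]
  have hsplit : (N : ℝ) ^ (2 - m) = (N : ℝ) ^ 2 / (N : ℝ) ^ m := by
    rw [Real.rpow_sub hNpos, Real.rpow_two]
  rw [hsplit, div_div_eq_mul_div, le_div_iff₀ (by positivity), div_mul_eq_mul_div, le_div_iff₀ hc]
  linarith [key]

/-! ## §5 Why each piece is WEAKER than 11071 (the transient band), and where the pieces come from -/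

/-- **11071 ∧ DeficitCesaroFloor ⟹ TransientFloor 1**: `Ov_N(cN²) = W_N(cN²) − cN²·E_N ≥ −C·N − c·C₁⁺·N`. [folklore] -/
theorem transientFloor_one_of_ohmicFloor_deficitCesaroFloor : OhmicFloor → DeficitCesaroFloor → TransientFloor 1 := by
  intro hO hCF ω₂ lam β γ hω hl hβ hγ T hT c hc
  obtain ⟨C₁, N₀, hfl⟩ := hO ω₂ lam β γ hω hl hβ hγ T hT
  obtain ⟨C, N₀', hW⟩ := hCF ω₂ lam β γ hω hl hβ hγ T hT c hc
  refine ⟨C + c * max C₁ 0, max (max N₀ N₀') 1, fun N hN => ?_⟩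
  have hN₀ : N₀ ≤ N := le_trans (le_trans (le_max_left _ _) (le_max_left _ _)) hN
  have hN₀' : N₀' ≤ N := le_trans (le_trans (le_max_right _ _) (le_max_left _ _)) hN
  have hNpos : (0 : ℝ) < N := by exact_mod_cast lt_of_lt_of_le Nat.one_pos (le_trans (le_max_right _ _) hN)
  have ht : (0 : ℝ) ≤ c * (N : ℝ) ^ 2 := by positivity
  have hid := deficitCesaro_eq_add hω hl hβ hγ hT N ht
  have h1 := hfl N hN₀
  have h2 := hW N hN₀'
  rw [Real.rpow_one]
  set E := escapeDeficit ω₂ lam β γ T N with hE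
  have hEN : E * N ≤ max C₁ 0 := by
    have := (le_div_iff₀ hNpos).mp (le_trans h1 (div_le_div_of_nonneg_right (le_max_left C₁ 0) hNpos.le))
    linarith
  have : c * (N : ℝ) ^ 2 * E ≤ c * max C₁ 0 * N := by nlinarith [hEN, hc, hNpos]
  nlinarith [hid, h1, h2, this]

/-- `BoundedResponse ∧ DeficitCesaroFloor ⟹ TransientFloor 1`. [folklore] -/
theorem transientFloor_one_of_boundedResponse_deficitCesaroFloor : BoundedResponse → DeficitCesaroFloor → TransientFloor 1 :=
  fun hB => transientFloor_one_of_ohmicFloor_deficitCesaroFloor (ohmicFloor_iff_boundedResponse.mpr hB)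

/-- **11071 ∧ TransientCeilingPoint ⟹ DeficitCesaroPoint**: `W_N(cN²) = cN²·E_N + Ov_N(cN²) ≤ c·C₁⁺·N + C·N`. [folklore] -/
theorem deficitCesaroPoint_of_ohmicFloor_transientCeiling : OhmicFloor → TransientCeilingPoint → DeficitCesaroPoint := by
  intro hO hU ω₂ lam β γ hω hl hβ hγ T hT
  obtain ⟨C₁, N₀, hfl⟩ := hO ω₂ lam β γ hω hl hβ hγ T hT
  obtain ⟨C, c, hc, N₀', hOv⟩ := hU ω₂ lam β γ hω hl hβ hγ T hT
  refine ⟨C + c * max C₁ 0, c, hc, max (max N₀ N₀') 1, fun N hN => ?_⟩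
  have hN₀ : N₀ ≤ N := le_trans (le_trans (le_max_left _ _) (le_max_left _ _)) hN
  have hN₀' : N₀' ≤ N := le_trans (le_trans (le_max_right _ _) (le_max_left _ _)) hN
  have hNpos : (0 : ℝ) < N := by exact_mod_cast lt_of_lt_of_le Nat.one_pos (le_trans (le_max_right _ _) hN)
  have ht : (0 : ℝ) ≤ c * (N : ℝ) ^ 2 := by positivity
  have hid := deficitCesaro_eq_add hω hl hβ hγ hT N ht
  have h1 := hfl N hN₀
  have h2 := hOv N hN₀'
  set E := escapeDeficit ω₂ lam β γ T N with hE
  have hEN : E * N ≤ max C₁ 0 := by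
    have := (le_div_iff₀ hNpos).mp (le_trans h1 (div_le_div_of_nonneg_right (le_max_left C₁ 0) hNpos.le))
    linarith
  have : c * (N : ℝ) ^ 2 * E ≤ c * max C₁ 0 * N := by nlinarith [hEN, hc, hNpos]
  nlinarith [hid, h2, this]

/-- **Modulo the `O(N)` transient band at the Thouless time, 11071 ≡ DeficitCesaroPoint.** [folklore] -/
theorem boundedResponse_iff_deficitCesaroPoint (hF : TransientFloor 1) (hU : TransientCeilingPoint) :
    BoundedResponse ↔ DeficitCesaroPoint :=
  ⟨fun hB => deficitCesaroPoint_of_ohmicFloor_transientCeiling (ohmicFloor_iff_boundedResponse.mpr hB) hU,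
    fun hD => boundedResponse_of_deficitCesaroPoint_transientFloor hD hF⟩

/-- **`BoundaryDEP ⟹ TransientFloor g`** for every grade (`K_N ≥ 0` makes `Ov_N ≥ 0`): the open crux 13198 of route
`GriffithsLimitExchange` discharges the floor half of the door; in particular it holds for the harmonic member. [folklore] -/
theorem transientFloor_of_boundaryDEP (g : ℝ) : BoundaryDEP → TransientFloor g := by
  intro hDEP ω₂ lam β γ hω hl hβ hγ T hT c hc
  have h := hDEP ω₂ lam β γ hω hl hβ hγ T hT
  dsimp only at h
  refine ⟨0, 0, fun N _ => ?_⟩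
  have hK : ∀ u : ℝ, 0 ≤ u → 0 ≤ escapeKernel ω₂ lam β γ T N u := fun u hu => (h N u hu).1
  rw [zero_mul, neg_zero]
  refine mul_nonneg (by positivity) (setIntegral_nonneg measurableSet_Ioi fun u hu => ?_)
  exact mul_nonneg (le_min (le_of_lt hu) (by positivity)) (hK u (le_of_lt hu))

/-- **The TAIL sign suffices**: if `∫_{(s,∞)} K_N ≥ 0` for all `s ≥ 0` (the form of `BoundaryDEP` actually consumed by the
`GriffithsLimitExchange` glue; weaker than `K_N ≥ 0`), then `θ_N(s) ≤ θ_N(∞)` pointwise, so `Ov_N(t) = ∫₀ᵗ(θ_N(∞) − θ_N(s)) ds ≥ 0`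
and `TransientFloor g` holds at every grade with constant `0`. [folklore] -/
theorem transientFloor_of_kernelTail_nonneg (g : ℝ)
    (h : ∀ ω₂ lam β γ : ℝ, 0 < ω₂ → 0 < lam → 0 < β → 0 < γ → ∀ T : ℝ, 0 < T → ∀ (N : ℕ) (s : ℝ), 0 ≤ s →
      0 ≤ ∫ u in Set.Ioi s, escapeKernel ω₂ lam β γ T N u) :
    TransientFloor g := by
  intro ω₂ lam β γ hω hl hβ hγ T hT c hc
  refine ⟨0, 0, fun N _ => ?_⟩
  have ht : (0 : ℝ) ≤ c * (N : ℝ) ^ 2 := by positivity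
  have hKi := integrableOn_escapeKernel hω hl hβ hγ hT N
  rw [zero_mul, neg_zero, ← integral_transient_eq hω hl hβ hγ hT N ht]
  refine intervalIntegral.integral_nonneg ht fun s hs => ?_
  -- `(1 − θ_N(s)) − E_N = (γ/T²)·∫_{(s,∞)} K_N ≥ 0`
  have hsplit : ∫ u in Set.Ioi (0 : ℝ), escapeKernel ω₂ lam β γ T N u =
      (∫ u in (0 : ℝ)..s, escapeKernel ω₂ lam β γ T N u) + ∫ u in Set.Ioi s, escapeKernel ω₂ lam β γ T N u := by
    rw [intervalIntegral.integral_of_le hs.1, ← Set.Ioc_union_Ioi_eq_Ioi hs.1,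
      setIntegral_union (Set.Ioc_disjoint_Ioi_same) measurableSet_Ioi
        (hKi.mono_set Set.Ioc_subset_Ioi_self) (hKi.mono_set (Set.Ioi_subset_Ioi hs.1))]
  rw [escapeDeficit_eq, stepResponse, hsplit]
  have := h ω₂ lam β γ hω hl hβ hγ T hT N s hs.1
  have hc' : 0 ≤ γ / T ^ 2 := by positivity
  nlinarith [mul_nonneg hc' this]

/-- **`BoundaryDEP ⟹ DeficitCesaroFloor`** (`K_N ≥ 0 ⟹ θ_N ≤ 1 − E_N ≤ 1 ⟹ W_N ≥ 0`, `N ≥ 2`). [folklore] -/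
theorem deficitCesaroFloor_of_boundaryDEP : BoundaryDEP → DeficitCesaroFloor := by
  intro hDEP ω₂ lam β γ hω hl hβ hγ T hT c hc
  have h := hDEP ω₂ lam β γ hω hl hβ hγ T hT
  dsimp only at h
  refine ⟨0, 2, fun N hN => ?_⟩
  have hK : ∀ u : ℝ, 0 ≤ u → 0 ≤ escapeKernel ω₂ lam β γ T N u := fun u hu => (h N u hu).1
  have hE0 : 0 ≤ escapeDeficit ω₂ lam β γ T N := escapeDeficit_nonneg ω₂ lam β γ hω hl hβ hγ T hT N hN
  rw [zero_mul, neg_zero]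
  refine intervalIntegral.integral_nonneg (by positivity) fun s hs => ?_
  have := stepResponse_le_of_kernel_nonneg hω hl hβ hγ hT N hK hs.1
  linarith

/-- Hence **`DeficitCesaroPoint ∧ BoundaryDEP ⟹ BoundedResponse`** — 11071 from the (S)-stub at one time plus the
Griffiths sign (cf. the tree's `ohmicFloor_of_deficitCesaroEW_of_nonnegTransient`, whose sign hypothesis «transient ≥ 0 for
all t» sits between `BoundaryDEP` and `TransientFloor 1`). [folklore] -/
theorem boundedResponse_of_deficitCesaroPoint_boundaryDEP : DeficitCesaroPoint → BoundaryDEP → BoundedResponse :=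
  fun hD hDEP => boundedResponse_of_deficitCesaroPoint_transientFloor hD (transientFloor_of_boundaryDEP 1 hDEP)

/-- The tree's sign hypothesis (hypothesis 2 of `ohmicFloor_of_deficitCesaroEW_of_nonnegTransient`, in this file's names)
implies `TransientFloor g` for every `g`. [folklore] -/
theorem transientFloor_of_nonnegTransient (g : ℝ)
    (h : ∀ ω₂ lam β γ : ℝ, 0 < ω₂ → 0 < lam → 0 < β → 0 < γ → ∀ T : ℝ, 0 < T →
      ∃ N₁ : ℕ, ∀ N : ℕ, N₁ ≤ N → ∀ t : ℝ, 0 ≤ t →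
        0 ≤ ∫ s in (0 : ℝ)..t, ((1 - stepResponse ω₂ lam β γ T N s) - escapeDeficit ω₂ lam β γ T N)) :
    TransientFloor g := by
  intro ω₂ lam β γ hω hl hβ hγ T hT c hc
  obtain ⟨N₁, hN₁⟩ := h ω₂ lam β γ hω hl hβ hγ T hT
  refine ⟨0, N₁, fun N hN => ?_⟩
  have ht : (0 : ℝ) ≤ c * (N : ℝ) ^ 2 := by positivity
  rw [zero_mul, neg_zero, ← integral_transient_eq hω hl hβ hγ hT N ht]
  exact hN₁ N hN _ ht

/-- **The stub at one time**: `stub_deficitCesaroEW` (VERBATIM hypothesis 1 of `ohmicFloor_of_deficitCesaroEW_of_nonnegTransient`,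
in this file's names) `⟹ DeficitCesaroPoint` (`t = cN² ≥ 1` once `N > 1/c`). [folklore] -/
theorem deficitCesaroPoint_of_deficitCesaroEW
    (h : ∀ ω₂ lam β γ : ℝ, 0 < ω₂ → 0 < lam → 0 < β → 0 < γ → ∀ T : ℝ, 0 < T →
      ∃ C c : ℝ, 0 < c ∧ ∃ N₀ : ℕ, ∀ N : ℕ, N₀ ≤ N → ∀ t : ℝ, 1 ≤ t → t ≤ c * (N : ℝ) ^ 2 →
        deficitCesaro ω₂ lam β γ T N t ≤ C * Real.sqrt t) :
    DeficitCesaroPoint := by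
  intro ω₂ lam β γ hω hl hβ hγ T hT
  obtain ⟨C, c, hc, N₀, hW⟩ := h ω₂ lam β γ hω hl hβ hγ T hT
  refine ⟨C * Real.sqrt c, c, hc, max N₀ (⌈1 / c⌉₊ + 1), fun N hN => ?_⟩
  have hN₀ : N₀ ≤ N := le_trans (le_max_left _ _) hN
  have hN1 : ⌈1 / c⌉₊ + 1 ≤ N := le_trans (le_max_right _ _) hN
  have hNr : 1 / c < (N : ℝ) := by
    have := Nat.ceil_le.mp (Nat.le_of_succ_le hN1)
    have h' : (⌈1 / c⌉₊ : ℝ) + 1 ≤ N := by exact_mod_cast hN1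
    linarith [Nat.le_ceil (1 / c)]
  have hNpos : (0 : ℝ) < N := lt_trans (by positivity) hNr
  have hN1r : (1 : ℝ) ≤ N := by exact_mod_cast Nat.one_le_iff_ne_zero.mpr (by rintro rfl; simp at hNpos)
  have hcN : 1 < c * N := by rwa [div_lt_iff₀ hc, mul_comm] at hNr
  have ht1 : (1 : ℝ) ≤ c * (N : ℝ) ^ 2 := by nlinarith [hcN, hN1r, hc]
  have := hW N hN₀ (c * (N : ℝ) ^ 2) ht1 le_rfl
  rwa [Real.sqrt_mul hc.le, Real.sqrt_sq hNpos.le, ← mul_assoc] at this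

/-- **`TransientEW` at one time**: the tree's inline hypothesis `TransientEW` (hypothesis 2 of p138777 /
`subdiffusiveBondHeat_of_boundedResponse_transientEW`, in this file's names) `⟹ TransientCeilingPoint`. [folklore] -/
theorem transientCeilingPoint_of_transientEW
    (h : ∀ ω₂ lam β γ : ℝ, 0 < ω₂ → 0 < lam → 0 < β → 0 < γ → ∀ T : ℝ, 0 < T →
      ∃ C₂ c : ℝ, 0 < c ∧ ∃ N₀ : ℕ, ∀ N : ℕ, N₀ ≤ N → ∀ t : ℝ, 1 ≤ t → t ≤ c * (N : ℝ) ^ 2 →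
        (∫ s in (0 : ℝ)..t, ((1 - stepResponse ω₂ lam β γ T N s) - escapeDeficit ω₂ lam β γ T N)) ≤
          C₂ * Real.sqrt t) :
    TransientCeilingPoint := by
  intro ω₂ lam β γ hω hl hβ hγ T hT
  obtain ⟨C, c, hc, N₀, hW⟩ := h ω₂ lam β γ hω hl hβ hγ T hT
  refine ⟨C * Real.sqrt c, c, hc, max N₀ (⌈1 / c⌉₊ + 1), fun N hN => ?_⟩
  have hN₀ : N₀ ≤ N := le_trans (le_max_left _ _) hN
  have hN1 : ⌈1 / c⌉₊ + 1 ≤ N := le_trans (le_max_right _ _) hN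
  have hNr : 1 / c < (N : ℝ) := by
    have h' : (⌈1 / c⌉₊ : ℝ) + 1 ≤ N := by exact_mod_cast hN1
    linarith [Nat.le_ceil (1 / c)]
  have hNpos : (0 : ℝ) < N := lt_trans (by positivity) hNr
  have hN1r : (1 : ℝ) ≤ N := by exact_mod_cast Nat.one_le_iff_ne_zero.mpr (by rintro rfl; simp at hNpos)
  have hcN : 1 < c * N := by rwa [div_lt_iff₀ hc, mul_comm] at hNr
  have ht1 : (1 : ℝ) ≤ c * (N : ℝ) ^ 2 := by nlinarith [hcN, hN1r, hc]
  have := hW N hN₀ (c * (N : ℝ) ^ 2) ht1 le_rfl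
  rwa [Real.sqrt_mul hc.le, Real.sqrt_sq hNpos.le, ← mul_assoc,
    integral_transient_eq hω hl hβ hγ hT N (le_trans zero_le_one ht1)] at this

end Summit.AtomisticToContinuum.FouriersLaw.Theorems.BoundedResponse.TransientBand

end
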